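import Literature.Analysis.FluidPDE.PerturbedNSFourierData
import HarnessLib

/-!
# Synthesis of the short-time solution of the perturbed Navier–Stokes system: smoothness, reality, dictionary, datum

Analysis/FluidPDE proof file, sequel of `PerturbedNSFourierData` in the chain
`PerturbedNSFourier*` (short-time smooth solutions of
`∂ₜv + (v·∇)v + (u·∇)v + (v·∇)u + ∇q = νΔv`, `div v = 0`, `v(0) = v₀` around a smooth
divergence-free background on `T^d`, `#d ≤ 3`; Majda–Bertozzi 2002, Thm. 3.4; Cheskidov–Luo
2022, §3.1 (3.2)). Under the threshold hypotheses `BallHyp` for the data of a jointly smooth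
divergence-free background `u` on `[0, θ] × T^d` and a smooth divergence-free mean-zero datum
`v₀`, the coefficient field `c = solCoeff ν θ u v₀` and the synthesized fields satisfy
(`synth_spec`; the twin of `CorrectorFourierSynthesis.synth_spec` with the datum clause of
`LinearisedNSFourierSynthesis.synth_spec`):

* the complex velocity components `Vₗ = velC ν θ u v₀ l = ∑ₖ c(l,t,k) e_k` and the complex
  pressure `Q = presC ν θ u v₀` are jointly smooth on `[0, θ] × T^d`
  (`ScalarFourier.isSmoothSpaceTimeOn_torusSynth`: families of every order), the `Vₗ` and `Q`
  are **real** (conjugation symmetry of `c`), `Vₗ = (velₗ : ℂ)`, `Q = (pres : ℂ)`, and the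
  real fields `vel`, `pres` are jointly smooth;
* the Fourier dictionary at `t ∈ [0, θ]`: `𝓕(Vₗ) = cₗ`, `𝓕(∂ₜVₗ) = -νₖcₗ - (P G)ₗ`,
  `𝓕(Q) = q̂` (Grafakos 2014, §3.3.1, Prop. 3.2.7);
* the datum: `Vₗ(0, x) = (v₀(x)ₗ : ℂ)` by pointwise Fourier inversion
  (`ScalarFourier.tsum_mFourierCoeff_mul_mFourier`), hence `vel ν θ u v₀ 0 = v₀`.

## References

* A. J. Majda, A. L. Bertozzi, *Vorticity and Incompressible Flow*, CUP 2002, Thm. 3.4. [`MajdaBertozziCUP2002`]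
* A. Cheskidov, X. Luo, arXiv:2009.06596, §3.1 (3.2). [`CheskidovLuo2022`]
* L. Grafakos, *Classical Fourier Analysis*, 3rd ed. (2014), Prop. 3.2.5, 3.2.7, §3.3.1. [`Grafakos2014`]
-/

noncomputable section

open MeasureTheory Real Set Filter Topology UnitAddTorus

namespace Literature.Analysis.FluidPDE

namespace PerturbedNSFourier

open scoped ComplexConjugate ContDiff
open ScalarFourier
open CorrectorFourier (leraySym projSym presCoef presCoef_apply convSym convSym_neg_eq_conj driftCoeff
  driftCoeff_neg_eq_conj)
open LinearisedNSFourier (datumCoeff isSmooth_datumComp)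
open FourierNS (HasDecay clamp)
open Literature.Analysis.FunctionSpaces.Torus (freqNormSq IsSmooth)

variable {d : Type*} [Fintype d] [DecidableEq d]
variable {ν θ : ℝ} {u : ℝ → UnitAddTorus d → EuclideanSpace ℝ d}
  {v₀ : UnitAddTorus d → EuclideanSpace ℝ d} {Z ρ A : ℝ}

/-! ### Reality of the pressure coefficients -/

/-- The pressure coefficients of conjugate-symmetric data and solution are conjugate symmetric
(`-(k·G(-k))/(2πi|k|²)` against `conj`; the symbol is conjugate symmetric,
`CorrectorFourier.convSym_neg_eq_conj`). [folklore] -/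
theorem presCoeffField_neg_eq_conj (hconj : ∀ l t k, solCoeff ν θ u v₀ l t (-k) = conj (solCoeff ν θ u v₀ l t k))
    (t : ℝ) (k : d → ℤ) : presCoeffField ν θ u v₀ t (-k) = conj (presCoeffField ν θ u v₀ t k) := by
  have hR : ∀ (i j : d) (m : d → ℤ), (0 : d → d → (d → ℤ) → ℂ) i j (-m) =
      conj ((0 : d → d → (d → ℤ) → ℂ) i j m) := fun i j m => by simp
  have hG : ∀ m, convSym (fun j => driftCoeff θ u j t) 0 (fun j => solCoeff ν θ u v₀ j t) m (-k) =
      conj (convSym (fun j => driftCoeff θ u j t) 0 (fun j => solCoeff ν θ u v₀ j t) m k) := fun m =>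
    convSym_neg_eq_conj (fun j m' => driftCoeff_neg_eq_conj θ u j t m') hR (fun j m' => hconj j t m') m k
  have hD : conj (2 * π * Complex.I * (freqNormSq k : ℂ)) = -(2 * π * Complex.I * (freqNormSq k : ℂ)) := by
    rw [map_mul, map_mul, map_mul, Complex.conj_ofReal, Complex.conj_ofReal, Complex.conj_I, map_ofNat]
    ring
  rw [presCoeffField_apply, presCoeffField_apply, presCoef_apply, presCoef_apply,
    FunctionSpaces.Torus.freqNormSq_neg, map_div₀, map_neg, hD, map_sum]
  have hnum : ∑ m, ((-k) m : ℂ) * convSym (fun j => driftCoeff θ u j t) 0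
      (fun j => solCoeff ν θ u v₀ j t) m (-k) =
      -∑ m, conj ((k m : ℂ) * convSym (fun j => driftCoeff θ u j t) 0
        (fun j => solCoeff ν θ u v₀ j t) m k) := by
    rw [← Finset.sum_neg_distrib]
    refine Finset.sum_congr rfl fun m _ => ?_
    rw [Pi.neg_apply, Int.cast_neg, hG m, map_mul, map_intCast]
    ring
  rw [hnum, neg_neg, neg_div_neg_eq]

/-! ### Smoothness and reality of the synthesized fields; the dictionary; the datum -/

/-- **The synthesized fields of the short-time solution.** Under the threshold hypotheses, for
a jointly smooth divergence-free background `u` on `[0, θ] × T^d` and a smooth divergence-free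
mean-zero datum `v₀`: the complex velocity components `Vₗ = velC ν θ u v₀ l` and the complex
pressure `Q = presC ν θ u v₀` are jointly smooth on `[0, θ] × T^d`; they are real,
`Vₗ = (velₗ : ℂ)`, `Q = (pres : ℂ)`; the real velocity `vel ν θ u v₀` and pressure
`pres ν θ u v₀` are jointly smooth; the Fourier coefficients are `𝓕(Vₗ(t)) = c(l,t,·)` (all
`t`), `𝓕(∂ₜVₗ(t)) = -νₖ cₗ - (P G)ₗ` and `𝓕(Q(t)) = q̂(t,·)` for `t ∈ [0, θ]` (Grafakos 2014,
§3.3.1, Prop. 3.2.7); and the datum is attained, `Vₗ(0, x) = (v₀(x)ₗ : ℂ)` (pointwise Fourier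
inversion), so `vel ν θ u v₀ 0 = v₀`. [folklore] -/
theorem synth_spec (h : BallHyp ν θ (driftCoeff θ u) (datumCoeff v₀) Z ρ A)
    (hu : FunctionSpaces.Torus.IsSmoothSpaceTimeOn (Icc 0 θ) u)
    (hdiv : ∀ t ∈ Icc 0 θ, FunctionSpaces.Torus.IsDivFree (u t)) (hv₀ : IsSmooth v₀)
    (hv₀div : FunctionSpaces.Torus.IsDivFree v₀) (hv₀mean : FunctionSpaces.Torus.HasZeroMean v₀) :
    (∀ l, FunctionSpaces.Torus.IsSmoothSpaceTimeOn (Icc 0 θ) (velC ν θ u v₀ l)) ∧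
    FunctionSpaces.Torus.IsSmoothSpaceTimeOn (Icc 0 θ) (presC ν θ u v₀) ∧
    (∀ l t x, velC ν θ u v₀ l t x = ((vel ν θ u v₀ t x l : ℝ) : ℂ)) ∧
    (∀ t x, presC ν θ u v₀ t x = ((pres ν θ u v₀ t x : ℝ) : ℂ)) ∧
    FunctionSpaces.Torus.IsSmoothSpaceTimeOn (Icc 0 θ) (vel ν θ u v₀) ∧
    FunctionSpaces.Torus.IsSmoothSpaceTimeOn (Icc 0 θ) (pres ν θ u v₀) ∧
    (∀ l t k, mFourierCoeff (velC ν θ u v₀ l t) k = solCoeff ν θ u v₀ l t k) ∧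
    (∀ l, ∀ t ∈ Icc 0 θ, ∀ k,
      mFourierCoeff (FunctionSpaces.Torus.timeDerivWithin (Icc 0 θ) (velC ν θ u v₀ l) t) k =
      -(heatRate ν k : ℂ) * solCoeff ν θ u v₀ l t k -
        projSym (fun j => driftCoeff θ u j t) 0 (fun j => solCoeff ν θ u v₀ j t) l k) ∧
    (∀ t ∈ Icc 0 θ, ∀ k, mFourierCoeff (presC ν θ u v₀ t) k = presCoeffField ν θ u v₀ t k) ∧
    (∀ l x, velC ν θ u v₀ l 0 x = ((v₀ x l : ℝ) : ℂ)) ∧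
    vel ν θ u v₀ 0 = v₀ := by
  obtain ⟨hcc, hdecay, hdivF, hzero, hconj, hdatum, hderiv, hfam⟩ :=
    solCoeff_spec h hu hdiv hv₀ hv₀div hv₀mean
  have hθ := h.hθ
  have hUS : UniqueDiffOn ℝ (Icc 0 θ) := uniqueDiffOn_Icc hθ
  -- summability of the coefficients at every time
  obtain ⟨C₀, -, hC₀⟩ := hdecay (latOrder d)
  have hsum : ∀ l t, Summable fun k => ‖solCoeff ν θ u v₀ l t k‖ := fun l t =>
    summable_norm_of_hasDecay le_rfl (hC₀ l t)
  -- smoothness of the complex fields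
  have hV : ∀ l, FunctionSpaces.Torus.IsSmoothSpaceTimeOn (Icc 0 θ) (velC ν θ u v₀ l) := fun l =>
    isSmoothSpaceTimeOn_torusSynth hθ fun n => by
      obtain ⟨W, hW0, hW⟩ := hfam n
      exact ⟨W l, hW0 l, hW l⟩
  have hQ : FunctionSpaces.Torus.IsSmoothSpaceTimeOn (Icc 0 θ) (presC ν θ u v₀) :=
    isSmoothSpaceTimeOn_torusSynth hθ fun n => by
      obtain ⟨W, hW0, hW⟩ := hfam n
      exact exists_presFamily hθ hu hW0 hW
  -- reality
  have hVreal : ∀ l t x, velC ν θ u v₀ l t x = ((vel ν θ u v₀ t x l : ℝ) : ℂ) := by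
    intro l t x
    rw [vel_apply]
    refine CorrectorFourier.eq_ofReal_re_of_conj_eq ?_
    change conj (∑' k, solCoeff ν θ u v₀ l t k * mFourier k x) = ∑' k, solCoeff ν θ u v₀ l t k * mFourier k x
    exact CorrectorFourier.conj_tsum_mul_mFourier (hconj l t) x
  have hpresconj : ∀ t k, presCoeffField ν θ u v₀ t (-k) = conj (presCoeffField ν θ u v₀ t k) :=
    presCoeffField_neg_eq_conj hconj
  have hQreal : ∀ t x, presC ν θ u v₀ t x = ((pres ν θ u v₀ t x : ℝ) : ℂ) := by
    intro t x
    rw [pres_apply]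
    refine CorrectorFourier.eq_ofReal_re_of_conj_eq ?_
    change conj (∑' k, presCoeffField ν θ u v₀ t k * mFourier k x) =
      ∑' k, presCoeffField ν θ u v₀ t k * mFourier k x
    exact CorrectorFourier.conj_tsum_mul_mFourier (hpresconj t) x
  -- smoothness of the real fields
  have hvel : FunctionSpaces.Torus.IsSmoothSpaceTimeOn (Icc 0 θ) (vel ν θ u v₀) := by
    change ContDiffOn ℝ ∞ (FunctionSpaces.Torus.stLift (vel ν θ u v₀)) (Icc 0 θ ×ˢ univ)
    rw [contDiffOn_euclidean]
    intro l
    exact (hV l).clm_comp Complex.reCLM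
  have hpres : FunctionSpaces.Torus.IsSmoothSpaceTimeOn (Icc 0 θ) (pres ν θ u v₀) := hQ.clm_comp Complex.reCLM
  -- the dictionary
  have hcV : ∀ l t k, mFourierCoeff (velC ν θ u v₀ l t) k = solCoeff ν θ u v₀ l t k := fun l t k =>
    mFourierCoeff_tsum_mul_mFourier (hsum l t) k
  have hcVt : ∀ l, ∀ t ∈ Icc 0 θ, ∀ k,
      mFourierCoeff (FunctionSpaces.Torus.timeDerivWithin (Icc 0 θ) (velC ν θ u v₀ l) t) k =
      -(heatRate ν k : ℂ) * solCoeff ν θ u v₀ l t k -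
        projSym (fun j => driftCoeff θ u j t) 0 (fun j => solCoeff ν θ u v₀ j t) l k := by
    intro l t ht k
    obtain ⟨W, hW0, hW⟩ := hfam 1
    have hW1 : ∀ m, W l 1 t m = -(heatRate ν m : ℂ) * solCoeff ν θ u v₀ l t m -
        projSym (fun j => driftCoeff θ u j t) 0 (fun j => solCoeff ν θ u v₀ j t) l m := by
      intro m
      have h1 := (hW l).deriv 0 (by norm_num) m t ht
      rw [hW0] at h1
      exact (h1.derivWithin (hUS t ht)).symm.trans ((hderiv l m t ht).derivWithin (hUS t ht))
    have hdt : ∀ x, FunctionSpaces.Torus.timeDerivWithin (Icc 0 θ) (velC ν θ u v₀ l) t x =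
        torusSynth (W l 1) t x := by
      intro x
      have := timeDerivWithin_torusSynth hθ (hW l) ht x
      rwa [hW0] at this
    obtain ⟨C1, -, hC1⟩ := (hW l).decay_nonneg le_rfl (latOrder d)
    have hsum1 : Summable fun m => ‖W l 1 t m‖ := summable_norm_of_hasDecay le_rfl (hC1 t ht)
    have hfun : FunctionSpaces.Torus.timeDerivWithin (Icc 0 θ) (velC ν θ u v₀ l) t =
        fun x => ∑' m, W l 1 t m * mFourier m x := funext hdt
    rw [hfun, mFourierCoeff_tsum_mul_mFourier hsum1 k, hW1 k]
  have hcQ : ∀ t ∈ Icc 0 θ, ∀ k, mFourierCoeff (presC ν θ u v₀ t) k = presCoeffField ν θ u v₀ t k := by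
    intro t ht k
    obtain ⟨W, hW0, hW⟩ := hfam 0
    obtain ⟨Qf, hQ0, hQf⟩ := exists_presFamily hθ hu hW0 hW
    obtain ⟨C0, -, hC0'⟩ := hQf.decay_nonneg le_rfl (latOrder d)
    have hsumQ : Summable fun m => ‖presCoeffField ν θ u v₀ t m‖ := by
      have := summable_norm_of_hasDecay le_rfl (hC0' t ht)
      rwa [hQ0] at this
    exact mFourierCoeff_tsum_mul_mFourier hsumQ k
  -- the datum
  have hV0 : ∀ l x, velC ν θ u v₀ l 0 x = ((v₀ x l : ℝ) : ℂ) := by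
    intro l x
    have hg : IsSmooth (fun y => ((v₀ y l : ℝ) : ℂ)) := isSmooth_datumComp hv₀ l
    change (∑' k, solCoeff ν θ u v₀ l 0 k * mFourier k x) = _
    have hc0 : solCoeff ν θ u v₀ l 0 = datumCoeff v₀ l := funext fun k => hdatum l k
    rw [hc0]
    exact tsum_mFourierCoeff_mul_mFourier hg.continuous (summable_norm_mFourierCoeff hg) x
  refine ⟨hV, hQ, hVreal, hQreal, hvel, hpres, hcV, hcVt, hcQ, hV0, ?_⟩
  funext x
  ext l
  rw [vel_apply, hV0 l x, Complex.ofReal_re]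

end PerturbedNSFourier

end Literature.Analysis.FluidPDE

end
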